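import Summits.HodgeConjecture.FermatCycles.ShiodaConditionFourfoldFiftySevenA
import HarnessLib

/-!
# Shioda's condition `(P⁴₅₇)` by kernel exhaustion — part B (`a ≥ 7`) and the theorem

HONEST FRAMING: explicit algebraic cycles for specific Hodge classes on Fermat/Delsarte varieties;
residual open instances listed; no claim on general Hodge.

Second half of the `N = 57` search (chunks `a = 7, 8, 9`, `[10,12)`, `[12,14)`, `[14,16)`, `[16,20)`, `[20,57)`: 273 330 tuples) and the
assembly with part A (`ShiodaConditionFourfoldFiftySevenA.lean`) through `shiodaConditionUpTo_four_of_chunks`: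
**`shiodaConditionUpTo_fiftySeven_four : ShiodaConditionUpTo 57 4`** — every Hodge `6`-multiset over `ℤ/57` is decomposable,
quasi-decomposable or semi-decomposable (the arithmetic hypothesis of Shioda's Theorem 1 for `X⁴₅₇`; cell P4-TABLE, two implementations
+ referee; here the kernel). THEOREMS ONLY; topic path of cell `pub-hfermat` (new work, not literature).

PRINT STATUS (lit seat, 2026-08-20): no REFEREED theorem covers this degree; PUBLIC PRIORITY for HC(X⁴ₘ) at every odd `m ≤ 199` belongs to the
computer-assisted preprint [Jumagulov2026OddFermatFourfolds] (arXiv:2608.18134, July 2026; Thm 1.1, census Thm 1.5), whose Appendix C row at this level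
(`m = 57`: 265 Galois orbits = 264 decomposable + 1 quasi-decomposable) the cell reproduces by two independent enumerations (`code/lit/census/orbits.py`); this file is an INDEPENDENT
certificate checked by the Lean kernel, not a first claim.

References: [Shioda1979PJA] T. Shioda, Proc. Japan Acad. 55A (1979) §1 (Pⁿₘ), §2 Thm 1; [daSilva2021HodgeFermat] Def. 2.4, Prop. 3.1.
[Jumagulov2026OddFermatFourfolds] R. Jumagulov, arXiv:2608.18134 (preprint, July 2026), Thm 1.1, Thm 1.5, Appendix C.
-/

namespace Summit.HodgeConjecture.FermatCycles.ShiodaConditionFourfold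

open Multiset
open Literature.AlgebraicGeometry.HodgeTheory Literature.AlgebraicGeometry.HodgeTheory.FermatCharacter

set_option maxHeartbeats 0 in
/-- The search at `N = 57`, first representatives `a = 7` (35883 tuples). Kernel. [cite: Shioda1979PJA, §1 condition (Pⁿₘ), n = 4] -/
theorem checkB6_57_7 : checkB6 57 7 1 = true := by decide +kernel

set_option maxHeartbeats 0 in
/-- The search at `N = 57`, first representatives `a = 8` (33624 tuples). Kernel. [cite: Shioda1979PJA, §1 condition (Pⁿₘ), n = 4] -/
theorem checkB6_57_8 : checkB6 57 8 1 = true := by decide +kernel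

set_option maxHeartbeats 0 in
/-- The search at `N = 57`, first representatives `a = 9` (31174 tuples). Kernel. [cite: Shioda1979PJA, §1 condition (Pⁿₘ), n = 4] -/
theorem checkB6_57_9 : checkB6 57 9 1 = true := by decide +kernel

set_option maxHeartbeats 0 in
/-- The search at `N = 57`, first representatives `a ∈ [10, 12)` (54364 tuples). Kernel. [cite: Shioda1979PJA, §1 condition (Pⁿₘ), n = 4] -/
theorem checkB6_57_10 : checkB6 57 10 2 = true := by decide +kernel

set_option maxHeartbeats 0 in
/-- The search at `N = 57`, first representatives `a ∈ [12, 14)` (43078 tuples). Kernel. [cite: Shioda1979PJA, §1 condition (Pⁿₘ), n = 4] -/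
theorem checkB6_57_12 : checkB6 57 12 2 = true := by decide +kernel

set_option maxHeartbeats 0 in
/-- The search at `N = 57`, first representatives `a ∈ [14, 16)` (31717 tuples). Kernel. [cite: Shioda1979PJA, §1 condition (Pⁿₘ), n = 4] -/
theorem checkB6_57_14 : checkB6 57 14 2 = true := by decide +kernel

set_option maxHeartbeats 0 in
/-- The search at `N = 57`, first representatives `a ∈ [16, 20)` (33839 tuples). Kernel. [cite: Shioda1979PJA, §1 condition (Pⁿₘ), n = 4] -/
theorem checkB6_57_16 : checkB6 57 16 4 = true := by decide +kernel

set_option maxHeartbeats 0 in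
/-- The search at `N = 57`, first representatives `a ∈ [20, 57)` (9651 tuples). Kernel. [cite: Shioda1979PJA, §1 condition (Pⁿₘ), n = 4] -/
theorem checkB6_57_20 : checkB6 57 20 37 = true := by decide +kernel

/-- **`(P⁴₅₇)` holds**: every Hodge `6`-multiset over `ℤ/57` (every Hodge character of the Fermat fourfold `X⁴₅₇` up to
permutation) is decomposable, quasi-decomposable or semi-decomposable — the arithmetic hypothesis of Shioda's Theorem 1 for `X⁴₅₇`,
a degree covered by no refereed theorem (public priority: the census of the preprint [Jumagulov2026OddFermatFourfolds,
Thm 1.5 / App. C]; this certificate is independent); certified by the cell's enumeration (P4-TABLE) and here by the kernel (parts A and B).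
[cite: Shioda1979PJA, §1 condition (Pⁿₘ) and §2 Thm 1] -/
theorem shiodaConditionUpTo_fiftySeven_four : ShiodaConditionUpTo 57 4 :=
  shiodaConditionUpTo_four_of_chunks 57 [(1, 1), (2, 1), (3, 1), (4, 1), (5, 1), (6, 1), (7, 1), (8, 1), (9, 1), (10, 2), (12, 2), (14, 2), (16, 4), (20, 37)]
    (by
      intro a ha0 ha
      rcases Nat.lt_or_ge a 2 with g1 | h1
      · exact ⟨(1, 1), by simp, by omega, by omega⟩
      rcases Nat.lt_or_ge a 3 with g2 | h2
      · exact ⟨(2, 1), by simp, h1, by omega⟩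
      rcases Nat.lt_or_ge a 4 with g3 | h3
      · exact ⟨(3, 1), by simp, h2, by omega⟩
      rcases Nat.lt_or_ge a 5 with g4 | h4
      · exact ⟨(4, 1), by simp, h3, by omega⟩
      rcases Nat.lt_or_ge a 6 with g5 | h5
      · exact ⟨(5, 1), by simp, h4, by omega⟩
      rcases Nat.lt_or_ge a 7 with g6 | h6
      · exact ⟨(6, 1), by simp, h5, by omega⟩
      rcases Nat.lt_or_ge a 8 with g7 | h7
      · exact ⟨(7, 1), by simp, h6, by omega⟩
      rcases Nat.lt_or_ge a 9 with g8 | h8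
      · exact ⟨(8, 1), by simp, h7, by omega⟩
      rcases Nat.lt_or_ge a 10 with g9 | h9
      · exact ⟨(9, 1), by simp, h8, by omega⟩
      rcases Nat.lt_or_ge a 12 with g10 | h10
      · exact ⟨(10, 2), by simp, h9, by omega⟩
      rcases Nat.lt_or_ge a 14 with g11 | h11
      · exact ⟨(12, 2), by simp, h10, by omega⟩
      rcases Nat.lt_or_ge a 16 with g12 | h12
      · exact ⟨(14, 2), by simp, h11, by omega⟩
      rcases Nat.lt_or_ge a 20 with g13 | h13
      · exact ⟨(16, 4), by simp, h12, by omega⟩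
      · exact ⟨(20, 37), by simp, h13, by omega⟩)
    (by
      intro p hp
      simp only [List.mem_cons, List.not_mem_nil, or_false] at hp
      rcases hp with rfl | rfl | rfl | rfl | rfl | rfl | rfl | rfl | rfl | rfl | rfl | rfl | rfl | rfl
      · exact checkB6_57_1
      · exact checkB6_57_2
      · exact checkB6_57_3
      · exact checkB6_57_4
      · exact checkB6_57_5
      · exact checkB6_57_6
      · exact checkB6_57_7
      · exact checkB6_57_8
      · exact checkB6_57_9
      · exact checkB6_57_10
      · exact checkB6_57_12
      · exact checkB6_57_14
      · exact checkB6_57_16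
      · exact checkB6_57_20)

/-- Consequence in the tree's currency: every Shioda-closed family of cycle characters mod `57` contains every Hodge character of
`X⁴₅₇`. [cite: Shioda1979PJA, §2 Thm 1 and §4] -/
theorem forall_of_isShiodaClosed_fiftySeven {C : Multiset (ZMod 57) → Prop} (hC : IsShiodaClosed C)
    (s : Multiset (ZMod 57)) (hs : IsHodgeMultiset s) (h0 : s ≠ 0) (h6 : card s ≤ 6) : C s :=
  hC.of_shiodaConditionUpTo shiodaConditionUpTo_fiftySeven_four s h0 hs h6

end Summit.HodgeConjecture.FermatCycles.ShiodaConditionFourfold
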